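import Mathlib
import Literature.Analysis.Calculus.MixedPartials

/-!
# Inverting a one-parameter family of real functions (inverse function theorem with a parameter)

Analysis/Calculus proof file (Mathlib + `MixedPartials`; theorems only, no definitions, no named
facts).

Let `g : ℝ → ℝ → ℝ`, `(t, s) ↦ g t s`, be `Cⁿ` near `(t₀, s₀)` (`n ≥ 1`) as a function of two
variables, with `∂ₛ g (t₀, s₀) ≠ 0`. Then the maps `s ↦ g t s` are inverted, simultaneously for all
`t` near `t₀` and locally near `s₀`, by a family `φ t` which is jointly `Cⁿ` at the base point:
`g t (φ t x) = x` and `φ t (g t s) = s` on a box around `(t₀, g t₀ s₀)`, resp. `(t₀, s₀)`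
(`exists_inverse_family`). This is the inverse function theorem for `(t, s) ↦ (t, g t s)`
(Mathlib's `ContDiffAt.toOpenPartialHomeomorph`), whose differential `(τ, σ) ↦ (τ, ∂ₜg τ + ∂ₛg σ)`
is invertible; the derivatives of `φ` at the base point are `∂ₓφ = 1 / ∂ₛg` and
`∂ₜφ = -∂ₜg / ∂ₛg`.

Application (`exists_graph_reparam`): an arc of a `Cⁿ` family of plane curves whose velocity has
non-zero first component is, for all nearby times at once, the graph of a function of the first
coordinate, jointly `Cⁿ` — the adapted coordinates in which two nearly tangent arcs of an evolving
knot diagram are compared by the difference of their heights over the common axis (second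
Reidemeister move; used towards `Literature.Topology.FourManifolds.Knot.reidemeisterR`).

## References

* J. Dieudonné, *Foundations of Modern Analysis* (1960), (10.2.5) (inverse functions),
  (10.2.1)–(10.2.3) (implicit functions depending on parameters). [folklore]
-/

noncomputable section

open scoped Topology
open Filter Set Function Metric

namespace Literature.Analysis.Calculus

/-- **Inverse function theorem with a parameter, one dimension.** Let `g : ℝ → ℝ → ℝ` be `Cⁿ`
near `(t₀, s₀)` as a function of `(t, s)`, `n ≠ 0`, with `∂ₛ g (t₀, s₀) = (g t₀)' s₀ ≠ 0`, and
put `x₀ = g t₀ s₀`. Then there are `φ : ℝ → ℝ → ℝ` and `δ > 0` with: `(t, x) ↦ φ t x` is `Cⁿ` at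
`(t₀, x₀)`; `φ t₀ x₀ = s₀`; `g t (φ t x) = x` for `|t - t₀| < δ`, `|x - x₀| < δ`;
`φ t (g t s) = s` for `|t - t₀| < δ`, `|s - s₀| < δ` (so nearby solutions of `g t s = x` are
`s = φ t x`); and the derivatives at the base point are `(φ t₀)' x₀ = ((g t₀)' s₀)⁻¹` and
`∂ₜφ (t₀, x₀) = -∂ₜg (t₀, s₀) / (g t₀)' s₀`. [folklore] -/
theorem exists_inverse_family {g : ℝ → ℝ → ℝ} {n : WithTop ℕ∞} {t₀ s₀ : ℝ}
    (hg : ContDiffAt ℝ n (uncurry g) (t₀, s₀)) (hn : n ≠ 0) (hgs : deriv (g t₀) s₀ ≠ 0) :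
    ∃ (φ : ℝ → ℝ → ℝ) (δ : ℝ), 0 < δ ∧
      ContDiffAt ℝ n (uncurry φ) (t₀, g t₀ s₀) ∧ φ t₀ (g t₀ s₀) = s₀ ∧
      (∀ t x, |t - t₀| < δ → |x - g t₀ s₀| < δ → g t (φ t x) = x) ∧
      (∀ t s, |t - t₀| < δ → |s - s₀| < δ → φ t (g t s) = s) ∧
      HasDerivAt (φ t₀) (deriv (g t₀) s₀)⁻¹ (g t₀ s₀) ∧
      HasDerivAt (fun t ↦ φ t (g t₀ s₀)) (-deriv (fun t ↦ g t s₀) t₀ / deriv (g t₀) s₀) t₀ := by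
  set x₀ : ℝ := g t₀ s₀ with hx₀
  set p₀ : ℝ × ℝ := (t₀, s₀) with hp₀
  -- the map `Ψ (t, s) = (t, g t s)` and its differential `L (τ, σ) = (τ, D (τ, σ))`
  set Ψ : ℝ × ℝ → ℝ × ℝ := fun p ↦ (p.1, uncurry g p) with hΨ
  have hΨc : ContDiffAt ℝ n Ψ p₀ := contDiffAt_fst.prodMk hg
  have hgd : DifferentiableAt ℝ (uncurry g) p₀ := hg.differentiableAt hn
  set D : ℝ × ℝ →L[ℝ] ℝ := fderiv ℝ (uncurry g) p₀ with hD
  set L : ℝ × ℝ →L[ℝ] ℝ × ℝ := (ContinuousLinearMap.fst ℝ ℝ ℝ).prod D with hL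
  have hΨL : HasFDerivAt Ψ L p₀ :=
    (ContinuousLinearMap.fst ℝ ℝ ℝ).hasFDerivAt.prodMk hgd.hasFDerivAt
  -- partial derivatives: `D (0, σ) = σ ∂ₛg`, `D (1, 0) = ∂ₜg`
  have hDs1 : D (0, 1) = deriv (g t₀) s₀ := by
    have h := (hasDerivAt_curry_right (q := p₀) hgd).deriv
    change deriv (g t₀) s₀ = D (0, 1) at h
    exact h.symm
  have hDs : ∀ σ : ℝ, D (0, σ) = σ * deriv (g t₀) s₀ := fun σ ↦ by
    have h1 : ((0 : ℝ), σ) = σ • ((0 : ℝ), (1 : ℝ)) := by simp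
    rw [h1, map_smul, smul_eq_mul, hDs1]
  have hDt : D (1, 0) = deriv (fun t ↦ g t s₀) t₀ := by
    have h := (hasDerivAt_curry_left (q := p₀) hgd).deriv
    change deriv (fun t ↦ g t s₀) t₀ = D (1, 0) at h
    exact h.symm
  have hDsplit : ∀ τ σ : ℝ, D (τ, σ) = τ * deriv (fun t ↦ g t s₀) t₀ + σ * deriv (g t₀) s₀ := by
    intro τ σ
    have h1 : ((τ : ℝ), σ) = τ • ((1 : ℝ), (0 : ℝ)) + ((0 : ℝ), σ) := by simp
    rw [h1, map_add, map_smul, smul_eq_mul, hDt, hDs]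
  -- `L` is injective (transversality `∂ₛg ≠ 0`), hence an isomorphism of the plane
  have hker : ∀ d : ℝ × ℝ, L d = 0 → d = 0 := by
    rintro ⟨τ, σ⟩ h
    change ((τ : ℝ), D (τ, σ)) = 0 at h
    rw [Prod.mk_eq_zero] at h
    obtain ⟨rfl, h2⟩ := h
    rw [hDs] at h2
    have hσ : σ = 0 := (mul_eq_zero.1 h2).resolve_right hgs
    rw [hσ]
    rfl
  have hLinj : Injective L := fun v w h ↦
    sub_eq_zero.1 (hker _ (by rw [map_sub, h, sub_self]))
  set E : (ℝ × ℝ) ≃L[ℝ] (ℝ × ℝ) := ContinuousLinearEquiv.ofBijective L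
    (LinearMap.ker_eq_bot.2 hLinj)
    (LinearMap.range_eq_top.2 (LinearMap.surjective_of_injective
      (f := (L : ℝ × ℝ →L[ℝ] ℝ × ℝ).toLinearMap) hLinj)) with hE
  have hEc : (E : ℝ × ℝ →L[ℝ] ℝ × ℝ) = L := ContinuousLinearEquiv.coe_ofBijective _ _ _
  have hΨE : HasFDerivAt Ψ (E : ℝ × ℝ →L[ℝ] ℝ × ℝ) p₀ := by
    rw [hEc]
    exact hΨL
  -- the local inverse
  set Φ := hΨc.toOpenPartialHomeomorph Ψ hΨE hn with hΦ
  have hΦf : (Φ : ℝ × ℝ → ℝ × ℝ) = Ψ := hΨc.toOpenPartialHomeomorph_coe hΨE hn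
  have hsrc : p₀ ∈ Φ.source := hΨc.mem_toOpenPartialHomeomorph_source hΨE hn
  have htgt : Ψ p₀ ∈ Φ.target := hΨc.image_mem_toOpenPartialHomeomorph_target hΨE hn
  have hΨ₀ : Ψ p₀ = (t₀, x₀) := rfl
  have hinvC : ContDiffAt ℝ n Φ.symm (t₀, x₀) := hΨc.to_localInverse hΨE hn
  have hinvD : HasStrictFDerivAt Φ.symm ((E.symm : (ℝ × ℝ) ≃L[ℝ] (ℝ × ℝ)) :
      ℝ × ℝ →L[ℝ] ℝ × ℝ) (t₀, x₀) := (hΨc.hasStrictFDerivAt' hΨE hn).to_localInverse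
  -- boxes inside the target and the source
  rw [hΨ₀] at htgt
  obtain ⟨r, hr, hrT⟩ := Metric.isOpen_iff.1 Φ.open_target _ htgt
  obtain ⟨r', hr', hrS⟩ := Metric.isOpen_iff.1 Φ.open_source _ hsrc
  have hmemT : ∀ t x, |t - t₀| < r → |x - x₀| < r → ((t, x) : ℝ × ℝ) ∈ Φ.target :=
    fun t x ht hx ↦ hrT (by
      rw [mem_ball, Prod.dist_eq, Real.dist_eq, Real.dist_eq]
      exact max_lt ht hx)
  have hmemS : ∀ t s, |t - t₀| < r' → |s - s₀| < r' → ((t, s) : ℝ × ℝ) ∈ Φ.source :=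
    fun t s ht hs ↦ hrS (by
      rw [mem_ball, Prod.dist_eq, Real.dist_eq, Real.dist_eq]
      exact max_lt ht hs)
  -- the family of inverses
  set φ : ℝ → ℝ → ℝ := fun t x ↦ (Φ.symm (t, x)).2 with hφ
  have hright : ∀ t x, |t - t₀| < r → |x - x₀| < r → Ψ (Φ.symm (t, x)) = (t, x) :=
    fun t x ht hx ↦ by
      rw [← hΦf]
      exact Φ.right_inv (hmemT t x ht hx)
  have hfst : ∀ t x, |t - t₀| < r → |x - x₀| < r → (Φ.symm (t, x)).1 = t := fun t x ht hx ↦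
    congrArg Prod.fst (hright t x ht hx)
  have hg_right : ∀ t x, |t - t₀| < r → |x - x₀| < r → g t (φ t x) = x := by
    intro t x ht hx
    have h : uncurry g (Φ.symm (t, x)) = x := congrArg Prod.snd (hright t x ht hx)
    rw [show uncurry g (Φ.symm (t, x)) = g (Φ.symm (t, x)).1 (Φ.symm (t, x)).2 from rfl,
      hfst t x ht hx] at h
    exact h
  have hg_left : ∀ t s, |t - t₀| < r' → |s - s₀| < r' → φ t (g t s) = s := by
    intro t s ht hs
    have h := Φ.left_inv (hmemS t s ht hs)
    rw [hΦf] at h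
    exact congrArg Prod.snd h
  have hφ₀ : φ t₀ x₀ = s₀ := by
    have h := hg_left t₀ s₀ (by rw [sub_self, abs_zero]; exact hr')
      (by rw [sub_self, abs_zero]; exact hr')
    exact h
  -- smoothness of `(t, x) ↦ φ t x = (Φ.symm (t, x)).2` at the base point
  have hφC : ContDiffAt ℝ n (uncurry φ) (t₀, x₀) := by
    have h : ContDiffAt ℝ n (fun p : ℝ × ℝ ↦ (Φ.symm p).2) (t₀, x₀) := contDiffAt_snd.comp _ hinvC
    exact h
  -- derivatives at the base point: `E.symm (0, 1)` and `E.symm (1, 0)`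
  set v : ℝ × ℝ := E.symm ((0 : ℝ), (1 : ℝ)) with hv
  set w : ℝ × ℝ := E.symm ((1 : ℝ), (0 : ℝ)) with hw
  have hLv : L v = ((0 : ℝ), (1 : ℝ)) := by
    rw [← hEc]; exact E.apply_symm_apply _
  have hLw : L w = ((1 : ℝ), (0 : ℝ)) := by
    rw [← hEc]; exact E.apply_symm_apply _
  have hv1 : v.1 = 0 := congrArg Prod.fst hLv
  have hw1 : w.1 = 1 := congrArg Prod.fst hLw
  have hv2 : v.2 = (deriv (g t₀) s₀)⁻¹ := by
    have h : D (v.1, v.2) = 1 := congrArg Prod.snd hLv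
    rw [hv1, hDs] at h
    field_simp
    linarith
  have hw2 : w.2 = -deriv (fun t ↦ g t s₀) t₀ / deriv (g t₀) s₀ := by
    have h : D (w.1, w.2) = 0 := congrArg Prod.snd hLw
    rw [hw1, hDsplit, one_mul] at h
    field_simp
    linarith
  have hdx : HasDerivAt (φ t₀) v.2 x₀ := by
    have hl : HasDerivAt (fun x : ℝ ↦ ((t₀, x) : ℝ × ℝ)) ((0 : ℝ), (1 : ℝ)) x₀ :=
      (hasDerivAt_const x₀ t₀).prodMk (hasDerivAt_id x₀)
    have h1 : HasDerivAt ((Φ.symm : ℝ × ℝ → ℝ × ℝ) ∘ fun x : ℝ ↦ ((t₀, x) : ℝ × ℝ)) v x₀ :=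
      hinvD.hasFDerivAt.comp_hasDerivAt x₀ hl
    have h2 := (ContinuousLinearMap.snd ℝ ℝ ℝ).hasFDerivAt.comp_hasDerivAt x₀ h1
    exact h2
  have hdt : HasDerivAt (fun t ↦ φ t x₀) w.2 t₀ := by
    have hl : HasDerivAt (fun t : ℝ ↦ ((t, x₀) : ℝ × ℝ)) ((1 : ℝ), (0 : ℝ)) t₀ :=
      (hasDerivAt_id t₀).prodMk (hasDerivAt_const t₀ x₀)
    have h1 : HasDerivAt ((Φ.symm : ℝ × ℝ → ℝ × ℝ) ∘ fun t : ℝ ↦ ((t, x₀) : ℝ × ℝ)) w t₀ :=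
      hinvD.hasFDerivAt.comp_hasDerivAt t₀ hl
    have h2 := (ContinuousLinearMap.snd ℝ ℝ ℝ).hasFDerivAt.comp_hasDerivAt t₀ h1
    exact h2
  refine ⟨φ, min r r', lt_min hr hr', hφC, hφ₀, fun t x ht hx ↦
    hg_right t x (ht.trans_le (min_le_left _ _)) (hx.trans_le (min_le_left _ _)),
    fun t s ht hs ↦ hg_left t s (ht.trans_le (min_le_right _ _)) (hs.trans_le (min_le_right _ _)),
    hv2 ▸ hdx, hw2 ▸ hdt⟩

/-- **An arc of an evolving plane curve as an evolving graph.** Let `Γ : ℝ → ℝ → ℝ × ℝ` be `Cⁿ`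
near `(t₀, s₀)` as a function of `(t, s)`, `n ≠ 0`, and let the velocity of the curve `Γ t₀` at
`s₀` have non-zero first component. Then for all times `t` near `t₀` at once, the arc of `Γ t`
near the parameter `s₀` is the graph of a function of the first coordinate: there are a
reparametrisation `φ t` by the first coordinate (`(Γ t (φ t x)).1 = x`, `φ t (Γ t s).1 = s` on
boxes around `(t₀, x₀)`, `(t₀, s₀)`, where `x₀ = (Γ t₀ s₀).1`), jointly `Cⁿ` at the base point,
so that the height of the arc over `x` is `(Γ t (φ t x)).2`. [folklore] -/
theorem exists_graph_reparam {Γ : ℝ → ℝ → ℝ × ℝ} {n : WithTop ℕ∞} {t₀ s₀ : ℝ}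
    (hΓ : ContDiffAt ℝ n (uncurry Γ) (t₀, s₀)) (hn : n ≠ 0) (h1 : (deriv (Γ t₀) s₀).1 ≠ 0) :
    ∃ (φ : ℝ → ℝ → ℝ) (δ : ℝ), 0 < δ ∧
      ContDiffAt ℝ n (uncurry φ) (t₀, (Γ t₀ s₀).1) ∧ φ t₀ (Γ t₀ s₀).1 = s₀ ∧
      (∀ t x, |t - t₀| < δ → |x - (Γ t₀ s₀).1| < δ → (Γ t (φ t x)).1 = x) ∧
      (∀ t s, |t - t₀| < δ → |s - s₀| < δ → φ t (Γ t s).1 = s) ∧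
      ContDiffAt ℝ n (uncurry fun t x ↦ (Γ t (φ t x)).2) (t₀, (Γ t₀ s₀).1) ∧
      HasDerivAt (φ t₀) ((deriv (Γ t₀) s₀).1)⁻¹ (Γ t₀ s₀).1 := by
  -- the first coordinate as a family of real functions
  set g : ℝ → ℝ → ℝ := fun t s ↦ (Γ t s).1 with hg
  have hgc : ContDiffAt ℝ n (uncurry g) (t₀, s₀) := by
    have h : ContDiffAt ℝ n (fun p : ℝ × ℝ ↦ (uncurry Γ p).1) (t₀, s₀) := contDiffAt_fst.comp _ hΓ
    exact h
  have hderiv : deriv (g t₀) s₀ = (deriv (Γ t₀) s₀).1 := by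
    have hd : DifferentiableAt ℝ (Γ t₀) s₀ := by
      have hc : ContDiffAt ℝ n (Γ t₀) s₀ :=
        hΓ.comp s₀ (contDiffAt_const.prodMk contDiffAt_id)
      exact hc.differentiableAt hn
    exact ((ContinuousLinearMap.fst ℝ ℝ ℝ).hasFDerivAt.comp_hasDerivAt s₀ hd.hasDerivAt).deriv
  have hgs : deriv (g t₀) s₀ ≠ 0 := by rwa [hderiv]
  obtain ⟨φ, δ, hδ, hφC, hφ₀, hright, hleft, hdx, -⟩ := exists_inverse_family hgc hn hgs
  refine ⟨φ, δ, hδ, hφC, hφ₀, hright, hleft, ?_, hderiv ▸ hdx⟩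
  -- the height over `x` is `Cⁿ`: second coordinate of `Γ` along `(t, φ t x)`
  have hpair : ContDiffAt ℝ n (fun p : ℝ × ℝ ↦ ((p.1, uncurry φ p) : ℝ × ℝ)) (t₀, (Γ t₀ s₀).1) :=
    contDiffAt_fst.prodMk hφC
  have hbase : (fun p : ℝ × ℝ ↦ ((p.1, uncurry φ p) : ℝ × ℝ)) (t₀, (Γ t₀ s₀).1) = (t₀, s₀) :=
    Prod.ext rfl hφ₀
  have hΓ' : ContDiffAt ℝ n (uncurry Γ)
      ((fun p : ℝ × ℝ ↦ ((p.1, uncurry φ p) : ℝ × ℝ)) (t₀, (Γ t₀ s₀).1)) := by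
    rw [hbase]
    exact hΓ
  have hcomp : ContDiffAt ℝ n (uncurry Γ ∘ fun p : ℝ × ℝ ↦ ((p.1, uncurry φ p) : ℝ × ℝ))
      (t₀, (Γ t₀ s₀).1) :=
    ContDiffAt.comp (f := fun p : ℝ × ℝ ↦ ((p.1, uncurry φ p) : ℝ × ℝ)) (t₀, (Γ t₀ s₀).1) hΓ' hpair
  exact contDiffAt_snd.comp _ hcomp

end Literature.Analysis.Calculus
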